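import Summits.Ventures.CertifiedManyBodySolver.Upper.GaugedShibaHoppingObservable
import HarnessLib

/-!
# From the readers' rows to the THREE-ROW claim node (energy / density / zero-field window / K₂ window)

HONEST FRAMING: first certified bounds; not a superconductivity verdict. Nothing here is a number or a row. IRD desk
(sr-mbsolver-ird-5); companion of `ProducersFrameSourcedBoxNode.lean` (five- and seven-conjunct nodes) and
`GaugedShibaHoppingObservable.lean` (K̃ closed forms + row transport).

hubbard-cq-obsth-2's announced node for a certified W5 state (speedrun INBOX l.21251): the five v1 conjuncts, the
zero-field window `e0lo·ab ≤ Re⟨ψ, A_C(μ,0)ψ⟩ ≤ e0hi·ab` and the NNN-hopping window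
`k2lo·ab ≤ Re⟨ψ, hamiltonian (rectBoxDiagGraph a b) 1 0 ψ⟩ ≤ k2hi·ab` — ALL about ONE witness `ψ`. Here that
nine-conjunct node is derived from the cleared Rayleigh rows a reader certifies on the transformed integer MPS `ψ̃`
(frame `S′ = partialParticleHole D↓ · orbitalPhase g`, `|g i| = 1`), with the explicit unit witness
`ψ := S′ψ̃/‖ψ̃‖` (`hasParity_gaugedShiba'_mulVec`, `star_dotProduct_normalisedFrame`, `observableLower/Upper_of_frameRow`):

* `sourcedBoxThreeRowNode_of_gaugedShibaWitness'` — rows stated on `S′ᴴ X S′` for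
  `X ∈ {A_C(μ,h), N, A_C(μ,0), hamiltonian (rectBoxDiagGraph a b) 1 0}`;
* `sourcedBoxThreeRowNode_of_producersRows` — the same with every `S′ᴴ X S′` replaced by its CLOSED FORM
  (`gaugedShiba'_conjTranspose_conj_dWaveSourceOpenBox`, `…_totalNumber`, `…_hamiltonian_zero`), i.e. hypotheses on the
  explicit operators an exact / interval reader evaluates;
* `sourcedBoxThreeRowNode_of_gaugedShibaWitness'_even` — the production case `Ñ = ab` (`HasParity 0`).

References: E. H. Lieb, Phys. Rev. Lett. 62 (1989) 1201, proof of Thm 2. Tree: the files above.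
-/

noncomputable section
namespace Summit.Ventures.CertifiedManyBodySolver
open Matrix Finset Literature.Probability.LatticeModels
open Literature.MathematicalPhysics.QuantumLattice Literature.MathematicalPhysics.QuantumLattice.TwoCluster
open Literature.Barriers.HubbardSuperconductivity HubbardWave0
open scoped ComplexOrder ComplexConjugate

section ThreeRow

variable (a b : ℕ)

/-- **THREE-ROW node from a witness in the frame `S′ = W · orbitalPhase g`**: an `Ñ`-particle `ψ̃` with `⟨ψ̃,ψ̃⟩ > 0` and
cleared Rayleigh rows of `S′ᴴ A_C(μ,h) S′` (upper), `S′ᴴ N S′` (window), `S′ᴴ A_C(μ,0) S′` (window) and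
`S′ᴴ · hamiltonian (rectBoxDiagGraph a b) 1 0 · S′` (window) yields ONE unit vector `ψ` of parity `Ñ + ab` carrying all nine
conjuncts. [cite: Lieb1989, proof of Theorem 2] -/
theorem sourcedBoxThreeRowNode_of_gaugedShibaWitness' (U μ h : ℝ) (e nlo nhi e0lo e0hi k2lo k2hi : ℚ)
    {g : Orb (Fin a ×ₗ Fin b) → ℂ} (hg : ∀ i, ‖g i‖ = 1) {Nt : ℕ} (ψt : Fock (Orb (Fin a ×ₗ Fin b)))
    (hN : IsNParticle Nt ψt) (hpos : 0 < (star ψt ⬝ᵥ ψt).re)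
    (hE : (star ψt ⬝ᵥ (((partialParticleHole (spinDownOrbitals : Finset (Orb (Fin a ×ₗ Fin b))) * orbitalPhase g)ᴴ *
            dWaveSourceOpenBox a b U μ h * (partialParticleHole (spinDownOrbitals : Finset (Orb (Fin a ×ₗ Fin b))) * orbitalPhase g)) *ᵥ ψt)).re
          ≤ (e : ℝ) * ((a : ℝ) * b) * (star ψt ⬝ᵥ ψt).re)
    (hlo : (nlo : ℝ) * ((a : ℝ) * b) * (star ψt ⬝ᵥ ψt).re ≤
          (star ψt ⬝ᵥ (((partialParticleHole (spinDownOrbitals : Finset (Orb (Fin a ×ₗ Fin b))) * orbitalPhase g)ᴴ *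
            totalNumber * (partialParticleHole (spinDownOrbitals : Finset (Orb (Fin a ×ₗ Fin b))) * orbitalPhase g)) *ᵥ ψt)).re)
    (hhi : (star ψt ⬝ᵥ (((partialParticleHole (spinDownOrbitals : Finset (Orb (Fin a ×ₗ Fin b))) * orbitalPhase g)ᴴ *
            totalNumber * (partialParticleHole (spinDownOrbitals : Finset (Orb (Fin a ×ₗ Fin b))) * orbitalPhase g)) *ᵥ ψt)).re
          ≤ (nhi : ℝ) * ((a : ℝ) * b) * (star ψt ⬝ᵥ ψt).re)
    (h0lo : (e0lo : ℝ) * ((a : ℝ) * b) * (star ψt ⬝ᵥ ψt).re ≤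
          (star ψt ⬝ᵥ (((partialParticleHole (spinDownOrbitals : Finset (Orb (Fin a ×ₗ Fin b))) * orbitalPhase g)ᴴ *
            dWaveSourceOpenBox a b U μ 0 * (partialParticleHole (spinDownOrbitals : Finset (Orb (Fin a ×ₗ Fin b))) * orbitalPhase g)) *ᵥ ψt)).re)
    (h0hi : (star ψt ⬝ᵥ (((partialParticleHole (spinDownOrbitals : Finset (Orb (Fin a ×ₗ Fin b))) * orbitalPhase g)ᴴ *
            dWaveSourceOpenBox a b U μ 0 * (partialParticleHole (spinDownOrbitals : Finset (Orb (Fin a ×ₗ Fin b))) * orbitalPhase g)) *ᵥ ψt)).re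
          ≤ (e0hi : ℝ) * ((a : ℝ) * b) * (star ψt ⬝ᵥ ψt).re)
    (hk2lo : (k2lo : ℝ) * ((a : ℝ) * b) * (star ψt ⬝ᵥ ψt).re ≤
          (star ψt ⬝ᵥ (((partialParticleHole (spinDownOrbitals : Finset (Orb (Fin a ×ₗ Fin b))) * orbitalPhase g)ᴴ *
            hamiltonian (rectBoxDiagGraph a b) 1 0 * (partialParticleHole (spinDownOrbitals : Finset (Orb (Fin a ×ₗ Fin b))) * orbitalPhase g)) *ᵥ ψt)).re)
    (hk2hi : (star ψt ⬝ᵥ (((partialParticleHole (spinDownOrbitals : Finset (Orb (Fin a ×ₗ Fin b))) * orbitalPhase g)ᴴ *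
            hamiltonian (rectBoxDiagGraph a b) 1 0 * (partialParticleHole (spinDownOrbitals : Finset (Orb (Fin a ×ₗ Fin b))) * orbitalPhase g)) *ᵥ ψt)).re
          ≤ (k2hi : ℝ) * ((a : ℝ) * b) * (star ψt ⬝ᵥ ψt).re) :
    ∃ ψ : Fock (Orb (Fin a ×ₗ Fin b)), HasParity (Nt + a * b) ψ ∧ star ψ ⬝ᵥ ψ = 1 ∧
      (star ψ ⬝ᵥ (dWaveSourceOpenBox a b U μ h *ᵥ ψ)).re ≤ ((e : ℚ) : ℝ) * ((a : ℝ) * b) ∧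
      ((nlo : ℚ) : ℝ) * ((a : ℝ) * b) ≤ (star ψ ⬝ᵥ (totalNumber *ᵥ ψ)).re ∧
      (star ψ ⬝ᵥ (totalNumber *ᵥ ψ)).re ≤ ((nhi : ℚ) : ℝ) * ((a : ℝ) * b) ∧
      ((e0lo : ℚ) : ℝ) * ((a : ℝ) * b) ≤ (star ψ ⬝ᵥ (dWaveSourceOpenBox a b U μ 0 *ᵥ ψ)).re ∧
      (star ψ ⬝ᵥ (dWaveSourceOpenBox a b U μ 0 *ᵥ ψ)).re ≤ ((e0hi : ℚ) : ℝ) * ((a : ℝ) * b) ∧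
      ((k2lo : ℚ) : ℝ) * ((a : ℝ) * b) ≤ (star ψ ⬝ᵥ (hamiltonian (rectBoxDiagGraph a b) 1 0 *ᵥ ψ)).re ∧
      (star ψ ⬝ᵥ (hamiltonian (rectBoxDiagGraph a b) 1 0 *ᵥ ψ)).re ≤ ((k2hi : ℚ) : ℝ) * ((a : ℝ) * b) := by
  set S := partialParticleHole (spinDownOrbitals : Finset (Orb (Fin a ×ₗ Fin b))) * orbitalPhase g with hS
  have hSS : Sᴴ * S = 1 :=
    conjTranspose_mul_self_of_mul (partialParticleHole_conjTranspose_mul _) (conjTranspose_orbitalPhase_mul hg)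
  refine ⟨(((1 / Real.sqrt (star ψt ⬝ᵥ ψt).re : ℝ)) : ℂ) • (S *ᵥ ψt), ?_, star_dotProduct_normalisedFrame hSS ψt hpos,
    ?_, ?_, ?_, ?_, ?_, ?_, ?_⟩
  · exact hasParity_smul _ (hasParity_gaugedShiba'_mulVec a b g hN)
  · simpa using observableUpper_of_frameRow S (dWaveSourceOpenBox a b U μ h) ψt hpos (hi := (e : ℝ)) (c := (a : ℝ) * b) hE
  · simpa using observableLower_of_frameRow S totalNumber ψt hpos (lo := (nlo : ℝ)) (c := (a : ℝ) * b) hlo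
  · simpa using observableUpper_of_frameRow S totalNumber ψt hpos (hi := (nhi : ℝ)) (c := (a : ℝ) * b) hhi
  · simpa using observableLower_of_frameRow S (dWaveSourceOpenBox a b U μ 0) ψt hpos (lo := (e0lo : ℝ)) (c := (a : ℝ) * b) h0lo
  · simpa using observableUpper_of_frameRow S (dWaveSourceOpenBox a b U μ 0) ψt hpos (hi := (e0hi : ℝ)) (c := (a : ℝ) * b) h0hi
  · simpa using observableLower_of_frameRow S (hamiltonian (rectBoxDiagGraph a b) 1 0) ψt hpos (lo := (k2lo : ℝ)) (c := (a : ℝ) * b) hk2lo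
  · simpa using observableUpper_of_frameRow S (hamiltonian (rectBoxDiagGraph a b) 1 0) ψt hpos (hi := (k2hi : ℝ)) (c := (a : ℝ) * b) hk2hi


/-- **THREE-ROW node from the readers' rows on the EXPLICIT operators** (producers' frame): the hypotheses of
`sourcedBoxThreeRowNode_of_gaugedShibaWitness'` with every `S′ᴴ X S′` replaced by its closed form —
`H̃ = dΓ(𝓗^ḡ) − μ·ab·1 + U(N↑ − Σ n↑n↓)` (and its `h = 0` version), `Ñ-operator = |Λ|·1 + Σ(n↑ − n↓)`,
`K̃₂ = dΓ(𝒦^ḡ)` with `𝒦 = bdgNambuMatrix(−[p∼_diag q]) 0 0` (`producersDiagHoppingMatrix_orb_orb` tabulates it for the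
producers' sign gauge). [cite: Lieb1989, proof of Theorem 2] -/
theorem sourcedBoxThreeRowNode_of_producersRows (U μ h : ℝ) (e nlo nhi e0lo e0hi k2lo k2hi : ℚ)
    {g : Orb (Fin a ×ₗ Fin b) → ℂ} (hg : ∀ i, ‖g i‖ = 1) {Nt : ℕ} (ψt : Fock (Orb (Fin a ×ₗ Fin b)))
    (hN : IsNParticle Nt ψt) (hpos : 0 < (star ψt ⬝ᵥ ψt).re)
    (hE : (star ψt ⬝ᵥ ((dGamma (Matrix.of fun i j => star (g i) * g j *
            bdgNambuMatrix
              (fun x y : Fin a ×ₗ Fin b => if (rectBoxGraph a b).Adj x y then -(1 : ℂ) else 0)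
              (fun u v : Fin a ×ₗ Fin b => -(h : ℂ) * dWaveBoxPairWeight a b (u, v)) μ i j) -
          ((μ : ℂ) * ((a : ℂ) * (b : ℂ))) • (1 : Matrix (Finset (Orb (Fin a ×ₗ Fin b))) (Finset (Orb (Fin a ×ₗ Fin b))) ℂ) +
          (U : ℂ) • ((∑ x : Fin a ×ₗ Fin b, numberOp x 0) - ∑ x : Fin a ×ₗ Fin b, numberOp x 0 * numberOp x 1)) *ᵥ ψt)).re
          ≤ (e : ℝ) * ((a : ℝ) * b) * (star ψt ⬝ᵥ ψt).re)
    (hlo : (nlo : ℝ) * ((a : ℝ) * b) * (star ψt ⬝ᵥ ψt).re ≤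
          (star ψt ⬝ᵥ ((((Fintype.card (Fin a ×ₗ Fin b) : ℂ)) •
              (1 : Matrix (Finset (Orb (Fin a ×ₗ Fin b))) (Finset (Orb (Fin a ×ₗ Fin b))) ℂ) +
            ∑ x : Fin a ×ₗ Fin b, (numberOp x 0 - numberOp x 1)) *ᵥ ψt)).re)
    (hhi : (star ψt ⬝ᵥ ((((Fintype.card (Fin a ×ₗ Fin b) : ℂ)) •
              (1 : Matrix (Finset (Orb (Fin a ×ₗ Fin b))) (Finset (Orb (Fin a ×ₗ Fin b))) ℂ) +
            ∑ x : Fin a ×ₗ Fin b, (numberOp x 0 - numberOp x 1)) *ᵥ ψt)).re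
          ≤ (nhi : ℝ) * ((a : ℝ) * b) * (star ψt ⬝ᵥ ψt).re)
    (h0lo : (e0lo : ℝ) * ((a : ℝ) * b) * (star ψt ⬝ᵥ ψt).re ≤
          (star ψt ⬝ᵥ ((dGamma (Matrix.of fun i j => star (g i) * g j *
            bdgNambuMatrix
              (fun x y : Fin a ×ₗ Fin b => if (rectBoxGraph a b).Adj x y then -(1 : ℂ) else 0)
              (fun u v : Fin a ×ₗ Fin b => -((0 : ℝ) : ℂ) * dWaveBoxPairWeight a b (u, v)) μ i j) -
          ((μ : ℂ) * ((a : ℂ) * (b : ℂ))) • (1 : Matrix (Finset (Orb (Fin a ×ₗ Fin b))) (Finset (Orb (Fin a ×ₗ Fin b))) ℂ) +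
          (U : ℂ) • ((∑ x : Fin a ×ₗ Fin b, numberOp x 0) - ∑ x : Fin a ×ₗ Fin b, numberOp x 0 * numberOp x 1)) *ᵥ ψt)).re)
    (h0hi : (star ψt ⬝ᵥ ((dGamma (Matrix.of fun i j => star (g i) * g j *
            bdgNambuMatrix
              (fun x y : Fin a ×ₗ Fin b => if (rectBoxGraph a b).Adj x y then -(1 : ℂ) else 0)
              (fun u v : Fin a ×ₗ Fin b => -((0 : ℝ) : ℂ) * dWaveBoxPairWeight a b (u, v)) μ i j) -
          ((μ : ℂ) * ((a : ℂ) * (b : ℂ))) • (1 : Matrix (Finset (Orb (Fin a ×ₗ Fin b))) (Finset (Orb (Fin a ×ₗ Fin b))) ℂ) +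
          (U : ℂ) • ((∑ x : Fin a ×ₗ Fin b, numberOp x 0) - ∑ x : Fin a ×ₗ Fin b, numberOp x 0 * numberOp x 1)) *ᵥ ψt)).re
          ≤ (e0hi : ℝ) * ((a : ℝ) * b) * (star ψt ⬝ᵥ ψt).re)
    (hk2lo : (k2lo : ℝ) * ((a : ℝ) * b) * (star ψt ⬝ᵥ ψt).re ≤
          (star ψt ⬝ᵥ ((dGamma (Matrix.of fun i j => star (g i) * g j *
            bdgNambuMatrix (fun x y : Fin a ×ₗ Fin b => if (rectBoxDiagGraph a b).Adj x y then -(1 : ℂ) else 0) 0 0 i j)) *ᵥ ψt)).re)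
    (hk2hi : (star ψt ⬝ᵥ ((dGamma (Matrix.of fun i j => star (g i) * g j *
            bdgNambuMatrix (fun x y : Fin a ×ₗ Fin b => if (rectBoxDiagGraph a b).Adj x y then -(1 : ℂ) else 0) 0 0 i j)) *ᵥ ψt)).re
          ≤ (k2hi : ℝ) * ((a : ℝ) * b) * (star ψt ⬝ᵥ ψt).re) :
    ∃ ψ : Fock (Orb (Fin a ×ₗ Fin b)), HasParity (Nt + a * b) ψ ∧ star ψ ⬝ᵥ ψ = 1 ∧
      (star ψ ⬝ᵥ (dWaveSourceOpenBox a b U μ h *ᵥ ψ)).re ≤ ((e : ℚ) : ℝ) * ((a : ℝ) * b) ∧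
      ((nlo : ℚ) : ℝ) * ((a : ℝ) * b) ≤ (star ψ ⬝ᵥ (totalNumber *ᵥ ψ)).re ∧
      (star ψ ⬝ᵥ (totalNumber *ᵥ ψ)).re ≤ ((nhi : ℚ) : ℝ) * ((a : ℝ) * b) ∧
      ((e0lo : ℚ) : ℝ) * ((a : ℝ) * b) ≤ (star ψ ⬝ᵥ (dWaveSourceOpenBox a b U μ 0 *ᵥ ψ)).re ∧
      (star ψ ⬝ᵥ (dWaveSourceOpenBox a b U μ 0 *ᵥ ψ)).re ≤ ((e0hi : ℚ) : ℝ) * ((a : ℝ) * b) ∧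
      ((k2lo : ℚ) : ℝ) * ((a : ℝ) * b) ≤ (star ψ ⬝ᵥ (hamiltonian (rectBoxDiagGraph a b) 1 0 *ᵥ ψ)).re ∧
      (star ψ ⬝ᵥ (hamiltonian (rectBoxDiagGraph a b) 1 0 *ᵥ ψ)).re ≤ ((k2hi : ℚ) : ℝ) * ((a : ℝ) * b) := by
  rw [← gaugedShiba'_conjTranspose_conj_dWaveSourceOpenBox a b U μ h hg] at hE
  rw [← gaugedShiba'_conjTranspose_conj_dWaveSourceOpenBox a b U μ 0 hg] at h0lo h0hi
  rw [← gaugedShiba'_conjTranspose_conj_totalNumber hg] at hlo hhi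
  have hK := gaugedShiba'_conjTranspose_conj_hamiltonian_zero (rectBoxDiagGraph a b) (1 : ℝ) hg
  simp only [Complex.ofReal_one] at hK
  rw [← hK] at hk2lo hk2hi
  exact sourcedBoxThreeRowNode_of_gaugedShibaWitness' a b U μ h e nlo nhi e0lo e0hi k2lo k2hi hg ψt hN hpos hE hlo hhi
    h0lo h0hi hk2lo hk2hi

/-- **Production case `Ñ = ab`** of the three-row node: parity `0` (nine conjuncts). [cite: Lieb1989, proof of Theorem 2] -/
theorem sourcedBoxThreeRowNode_of_gaugedShibaWitness'_even (U μ h : ℝ) (e nlo nhi e0lo e0hi k2lo k2hi : ℚ)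
    {g : Orb (Fin a ×ₗ Fin b) → ℂ} (hg : ∀ i, ‖g i‖ = 1) (ψt : Fock (Orb (Fin a ×ₗ Fin b)))
    (hN : IsNParticle (a * b) ψt) (hpos : 0 < (star ψt ⬝ᵥ ψt).re)
    (hE : (star ψt ⬝ᵥ (((partialParticleHole (spinDownOrbitals : Finset (Orb (Fin a ×ₗ Fin b))) * orbitalPhase g)ᴴ *
            dWaveSourceOpenBox a b U μ h * (partialParticleHole (spinDownOrbitals : Finset (Orb (Fin a ×ₗ Fin b))) * orbitalPhase g)) *ᵥ ψt)).re
          ≤ (e : ℝ) * ((a : ℝ) * b) * (star ψt ⬝ᵥ ψt).re)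
    (hlo : (nlo : ℝ) * ((a : ℝ) * b) * (star ψt ⬝ᵥ ψt).re ≤
          (star ψt ⬝ᵥ (((partialParticleHole (spinDownOrbitals : Finset (Orb (Fin a ×ₗ Fin b))) * orbitalPhase g)ᴴ *
            totalNumber * (partialParticleHole (spinDownOrbitals : Finset (Orb (Fin a ×ₗ Fin b))) * orbitalPhase g)) *ᵥ ψt)).re)
    (hhi : (star ψt ⬝ᵥ (((partialParticleHole (spinDownOrbitals : Finset (Orb (Fin a ×ₗ Fin b))) * orbitalPhase g)ᴴ *
            totalNumber * (partialParticleHole (spinDownOrbitals : Finset (Orb (Fin a ×ₗ Fin b))) * orbitalPhase g)) *ᵥ ψt)).re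
          ≤ (nhi : ℝ) * ((a : ℝ) * b) * (star ψt ⬝ᵥ ψt).re)
    (h0lo : (e0lo : ℝ) * ((a : ℝ) * b) * (star ψt ⬝ᵥ ψt).re ≤
          (star ψt ⬝ᵥ (((partialParticleHole (spinDownOrbitals : Finset (Orb (Fin a ×ₗ Fin b))) * orbitalPhase g)ᴴ *
            dWaveSourceOpenBox a b U μ 0 * (partialParticleHole (spinDownOrbitals : Finset (Orb (Fin a ×ₗ Fin b))) * orbitalPhase g)) *ᵥ ψt)).re)
    (h0hi : (star ψt ⬝ᵥ (((partialParticleHole (spinDownOrbitals : Finset (Orb (Fin a ×ₗ Fin b))) * orbitalPhase g)ᴴ *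
            dWaveSourceOpenBox a b U μ 0 * (partialParticleHole (spinDownOrbitals : Finset (Orb (Fin a ×ₗ Fin b))) * orbitalPhase g)) *ᵥ ψt)).re
          ≤ (e0hi : ℝ) * ((a : ℝ) * b) * (star ψt ⬝ᵥ ψt).re)
    (hk2lo : (k2lo : ℝ) * ((a : ℝ) * b) * (star ψt ⬝ᵥ ψt).re ≤
          (star ψt ⬝ᵥ (((partialParticleHole (spinDownOrbitals : Finset (Orb (Fin a ×ₗ Fin b))) * orbitalPhase g)ᴴ *
            hamiltonian (rectBoxDiagGraph a b) 1 0 * (partialParticleHole (spinDownOrbitals : Finset (Orb (Fin a ×ₗ Fin b))) * orbitalPhase g)) *ᵥ ψt)).re)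
    (hk2hi : (star ψt ⬝ᵥ (((partialParticleHole (spinDownOrbitals : Finset (Orb (Fin a ×ₗ Fin b))) * orbitalPhase g)ᴴ *
            hamiltonian (rectBoxDiagGraph a b) 1 0 * (partialParticleHole (spinDownOrbitals : Finset (Orb (Fin a ×ₗ Fin b))) * orbitalPhase g)) *ᵥ ψt)).re
          ≤ (k2hi : ℝ) * ((a : ℝ) * b) * (star ψt ⬝ᵥ ψt).re) :
    ∃ ψ : Fock (Orb (Fin a ×ₗ Fin b)), HasParity 0 ψ ∧ star ψ ⬝ᵥ ψ = 1 ∧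
      (star ψ ⬝ᵥ (dWaveSourceOpenBox a b U μ h *ᵥ ψ)).re ≤ ((e : ℚ) : ℝ) * ((a : ℝ) * b) ∧
      ((nlo : ℚ) : ℝ) * ((a : ℝ) * b) ≤ (star ψ ⬝ᵥ (totalNumber *ᵥ ψ)).re ∧
      (star ψ ⬝ᵥ (totalNumber *ᵥ ψ)).re ≤ ((nhi : ℚ) : ℝ) * ((a : ℝ) * b) ∧
      ((e0lo : ℚ) : ℝ) * ((a : ℝ) * b) ≤ (star ψ ⬝ᵥ (dWaveSourceOpenBox a b U μ 0 *ᵥ ψ)).re ∧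
      (star ψ ⬝ᵥ (dWaveSourceOpenBox a b U μ 0 *ᵥ ψ)).re ≤ ((e0hi : ℚ) : ℝ) * ((a : ℝ) * b) ∧
      ((k2lo : ℚ) : ℝ) * ((a : ℝ) * b) ≤ (star ψ ⬝ᵥ (hamiltonian (rectBoxDiagGraph a b) 1 0 *ᵥ ψ)).re ∧
      (star ψ ⬝ᵥ (hamiltonian (rectBoxDiagGraph a b) 1 0 *ᵥ ψ)).re ≤ ((k2hi : ℚ) : ℝ) * ((a : ℝ) * b) := by
  obtain ⟨ψ, hp, h1, h2, h3, h4, h5, h6, h7, h8⟩ := sourcedBoxThreeRowNode_of_gaugedShibaWitness' a b U μ h e nlo nhi e0lo e0hi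
    k2lo k2hi hg ψt hN hpos hE hlo hhi h0lo h0hi hk2lo hk2hi
  exact ⟨ψ, hp.mono (by omega), h1, h2, h3, h4, h5, h6, h7, h8⟩

end ThreeRow

end Summit.Ventures.CertifiedManyBodySolver
end
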